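import Summits.QuantumAdvantage.QuantumAdvantage.Theorems.CharDialAdaptiveCounterSubcubeB

/-! # CharDialAdaptiveCounterSubcube — part 3/3 (mechanical split for landing of `CharDialAdaptiveCounterSubcube`; content verbatim; scopes re-opened with their variables) -/


namespace Summit.QuantumAdvantage.AdviceFreeQNC0
open Finset AffBells22

namespace CounterLaw


/-! ## §6 The TWISTED floor: `Φ(μ) ≥ (Σ μ)/3 − (5p/2)·‖μ − μ∘(RA t)⁻¹‖₁` -/

section Floor

variable (p : ℕ) (v : ℕ → Bool → ZMod p → ZMod 3 → Bool × Bool)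

/-- the one-step twist of `(RA t)⁻¹`: `(RA t)⁻¹ (g, a, b) = (g ⊕ mS t a b, a − 1, b − 1)`. -/
def mS (t : ℕ) (a : ZMod 3) (b : ZMod p) : Bool × Bool :=
  bx (v t false b a) (v t true (b - 1) (a - 1))

/-- CharDialAdaptiveCounterSubcube helper `RA_symm_apply'`. -/
theorem RA_symm_apply' (t : ℕ) (x : St p) :
    (RA p v t).symm x = (bx x.1 (mS p v t x.2.1 x.2.2), x.2.1 - 1, x.2.2 - 1) := by
  rw [RA_symm_apply, mS, bx_assoc]

/-- the accumulated twist of `j` inverse steps. -/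
def nS (t : ℕ) : ℕ → ZMod 3 → ZMod p → Bool × Bool
  | 0, _, _ => (false, false)
  | j + 1, a, b => bx (nS t j a b) (mS p v t (a - j) (b - j))

/-- `(RA t)^{-j} (g, a, b) = (g ⊕ nS t j a b, a − j, b − j)`. -/
theorem RA_pow_symm_apply (t j : ℕ) (x : St p) :
    ((RA p v t) ^ j).symm x = (bx x.1 (nS p v t j x.2.1 x.2.2), x.2.1 - j, x.2.2 - j) := by
  induction j with
  | zero =>
    rcases x with ⟨g, a, b'⟩
    simp only [pow_zero, Equiv.Perm.one_def, Equiv.refl_symm, Equiv.refl_apply, nS, bx_zero, Nat.cast_zero, sub_zero]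
  | succ j ih =>
    rw [pow_succ, Equiv.Perm.mul_def, Equiv.symm_trans_apply, ih, RA_symm_apply']
    rcases x with ⟨g, a, b'⟩
    simp only [nS, bx_assoc, Nat.cast_succ, Prod.mk.injEq]
    exact ⟨trivial, by ring, by ring⟩

/-- the twist of one inverse step is admissible (in `a`, per counter fibre) when the fires are. -/
theorem mS_adm (hv : ∀ t β b, v t β b ∈ Adm) (t : ℕ) (b' : ZMod p) : (fun a => mS p v t a b') ∈ Adm := by
  have h1 : (fun a => v t true (b' - 1) (a - 1)) ∈ Adm := by
    simpa only [sub_eq_add_neg] using shift_mem_Adm (hv t true (b' - 1)) (-1)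
  simpa only [mS] using bx_mem_Adm (hv t false b') h1

/-- **the accumulated twist is admissible** (in `a`, for each counter fibre). -/
theorem nS_adm (hv : ∀ t β b, v t β b ∈ Adm) (t : ℕ) : ∀ (j : ℕ) (b' : ZMod p), (fun a => nS p v t j a b') ∈ Adm
  | 0, _ => mem_Adm.2 ⟨((false, false), false, 0), fun a => by simp only [nS, admV_zero]⟩
  | j + 1, b' => by
    have h₁ : (fun a => nS p v t j a b') ∈ Adm := nS_adm hv t j b'
    have h₂ : (fun a => mS p v t (a - j) (b' - j)) ∈ Adm := by
      simpa only [sub_eq_add_neg] using shift_mem_Adm (mS_adm p v hv t (b' - j)) (-(j : ZMod 3))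
    simpa only [nS] using bx_mem_Adm h₁ h₂

/-- the return to a counter fibre: `(RA t)^{-p} (g, a, b) = (g ⊕ nS t p a b, a − p, b)`. -/
theorem RA_pow_p_symm_apply (t : ℕ) (x : St p) :
    ((RA p v t) ^ p).symm x = (bx x.1 (nS p v t p x.2.1 x.2.2), x.2.1 - p, x.2.2) := by
  rw [RA_pow_symm_apply]; simp

/-- iterated returns are iterates of a twisted return map `retT π (−p)` with `π` the fibre's accumulated twist. -/
theorem RA_pow_mul_symm_apply (t : ℕ) (π : AdmP) (b' : ZMod p) (hπ : ∀ a, nS p v t p a b' = admV π a)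
    (k : ℕ) (g : Bool × Bool) (a : ZMod 3) :
    ((RA p v t) ^ (k * p)).symm (g, a, b')
      = (((retT π (-(p : ZMod 3)))^[k] (g, a)).1, ((retT π (-(p : ZMod 3)))^[k] (g, a)).2, b') := by
  induction k with
  | zero => simp [Equiv.Perm.one_def]
  | succ k ih =>
    rw [add_one_mul, pow_add, Equiv.Perm.mul_def, Equiv.symm_trans_apply, ih, RA_pow_p_symm_apply, hπ,
      Function.iterate_succ_apply', retT, sub_eq_add_neg]

/-- **the twisted two-block count on the state space**: for `3 ∤ p`, along the six returns `(RA t)^{-kp}`, `k < 6`,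
every member of `𝓛` is met at least twice. -/
theorem twist_count_ge_two (hv : ∀ t β b, v t β b ∈ Adm) (h3 : ¬ 3 ∣ p) (t : ℕ) (x : St p) (i : Idx) :
    2 ≤ ((range 6).filter fun k =>
      mem i (((RA p v t) ^ (k * p)).symm x).1 (((RA p v t) ^ (k * p)).symm x).2.1 = true).card := by
  obtain ⟨π, hπ⟩ := mem_Adm.1 (nS_adm p v hv t p x.2.2)
  have hq : (-(p : ZMod 3)) ≠ 0 := by
    rw [Ne, neg_eq_zero, ZMod.natCast_eq_zero_iff]; exact h3
  rcases x with ⟨g, a, b'⟩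
  have e : ∀ k : ℕ, ((RA p v t) ^ (k * p)).symm (g, a, b')
      = (((retT π (-(p : ZMod 3)))^[k] (g, a)).1, ((retT π (-(p : ZMod 3)))^[k] (g, a)).2, b') :=
    fun k => RA_pow_mul_symm_apply p v t π b' hπ k g a
  simp only [e]
  exact twisted_two_block π _ hq (g, a) i

variable [NeZero p]

/-- a sum over one counter fibre, as a sum over the state space. -/
theorem sum_fibreA (G : St p → ℝ) (b' : ZMod p) :
    ∑ x : St p, (if x.2.2 = b' then G x else 0) = ∑ g : Bool × Bool, ∑ a : ZMod 3, G (g, a, b') := by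
  rw [sum_St]
  have h : ∀ b'' : ZMod p, (∑ g : Bool × Bool, ∑ a : ZMod 3, if ((g, a, b'') : St p).2.2 = b' then G (g, a, b'') else 0)
      = if b'' = b' then ∑ g : Bool × Bool, ∑ a : ZMod 3, G (g, a, b'') else 0 := by
    intro b''
    by_cases hb : b'' = b'
    · simp [hb]
    · simp [hb]
  simp only [h]
  rw [Finset.sum_ite_eq' univ b']
  simp

/-- **THE TWISTED FLOOR.**  For `3 ∤ p` and every nonnegative law `μ`:
`Φ(μ) ≥ (Σ μ)/3 − (5p/2)·D1A t μ` — WITHOUT label averaging (the returns `(RA t)^{-kp}` stay in the fibre, move the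
label by `−kp` and twist the register admissibly; `twist_count_ge_two` + `‖μ − μ∘(RA t)^{-kp}‖₁ ≤ kp·D1A`). -/
theorem phi_ge_third_twist (hv : ∀ t β b, v t β b ∈ Adm) (h3 : ¬ 3 ∣ p) (t : ℕ) (μ : St p → ℝ)
    (hμ : ∀ x, 0 ≤ μ x) :
    (∑ x, μ x) / 3 - 5 / 2 * p * D1A p v t μ ≤ phi μ := by
  -- error terms
  have herr : ∀ k : ℕ, l1 μ (fun x => μ (((RA p v t) ^ (k * p)).symm x)) ≤ ((k * p : ℕ) : ℝ) * D1A p v t μ :=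
    fun k => l1_iterate_le (RA p v t) μ (k * p)
  have hb : ∀ (k : ℕ) (x : St p), (((RA p v t) ^ (k * p)).symm x).2.2 = x.2.2 := by
    intro k x; rw [RA_pow_symm_apply]; simp
  -- per fibre and member
  have hfib : ∀ (b' : ZMod p) (i : Idx),
      (∑ g : Bool × Bool, ∑ a : ZMod 3, μ (g, a, b')) / 3
        - (∑ k ∈ range 6, ∑ g : Bool × Bool, ∑ a : ZMod 3,
            |μ (g, a, b') - μ (((RA p v t) ^ (k * p)).symm (g, a, b'))|) / 6
        ≤ mass μ i b' := by
    intro b' i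
    -- reindexed masses
    have hre : ∀ k : ℕ, mass μ i b' = ∑ g : Bool × Bool, ∑ a : ZMod 3,
        (if mem i (((RA p v t) ^ (k * p)).symm (g, a, b')).1 (((RA p v t) ^ (k * p)).symm (g, a, b')).2.1 = true
          then μ (((RA p v t) ^ (k * p)).symm (g, a, b')) else 0) := by
      intro k
      have h1 : mass μ i b' = ∑ x : St p, if x.2.2 = b' then (if mem i x.1 x.2.1 = true then μ x else 0) else 0 := by
        rw [sum_fibreA]; rfl
      have h2 : ∑ x : St p, (if x.2.2 = b' then (if mem i x.1 x.2.1 = true then μ x else 0) else 0)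
          = ∑ x : St p, (if x.2.2 = b' then
              (if mem i (((RA p v t) ^ (k * p)).symm x).1 (((RA p v t) ^ (k * p)).symm x).2.1 = true
                then μ (((RA p v t) ^ (k * p)).symm x) else 0) else 0) := by
        rw [← Equiv.sum_comp ((RA p v t) ^ (k * p)).symm
          (fun x : St p => if x.2.2 = b' then (if mem i x.1 x.2.1 = true then μ x else 0) else 0)]
        refine sum_congr rfl fun x _ => ?_
        simp only [hb]
      rw [h1, h2, sum_fibreA]
    have hk : ∀ k : ℕ, (∑ g : Bool × Bool, ∑ a : ZMod 3,
          (if mem i (((RA p v t) ^ (k * p)).symm (g, a, b')).1 (((RA p v t) ^ (k * p)).symm (g, a, b')).2.1 = true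
            then μ (g, a, b') else 0))
        - (∑ g : Bool × Bool, ∑ a : ZMod 3, |μ (g, a, b') - μ (((RA p v t) ^ (k * p)).symm (g, a, b'))|)
        ≤ mass μ i b' := by
      intro k
      rw [hre k, ← sum_sub_distrib]
      refine sum_le_sum fun g _ => ?_
      rw [← sum_sub_distrib]
      refine sum_le_sum fun a _ => ?_
      split_ifs
      · linarith [le_abs_self (μ (g, a, b') - μ (((RA p v t) ^ (k * p)).symm (g, a, b')))]
      · linarith [abs_nonneg (μ (g, a, b') - μ (((RA p v t) ^ (k * p)).symm (g, a, b')))]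
    have hcount : 2 * ∑ g : Bool × Bool, ∑ a : ZMod 3, μ (g, a, b')
        ≤ ∑ k ∈ range 6, ∑ g : Bool × Bool, ∑ a : ZMod 3,
          (if mem i (((RA p v t) ^ (k * p)).symm (g, a, b')).1 (((RA p v t) ^ (k * p)).symm (g, a, b')).2.1 = true
            then μ (g, a, b') else 0) := by
      have hsw : ∑ k ∈ range 6, ∑ g : Bool × Bool, ∑ a : ZMod 3,
          (if mem i (((RA p v t) ^ (k * p)).symm (g, a, b')).1 (((RA p v t) ^ (k * p)).symm (g, a, b')).2.1 = true
            then μ (g, a, b') else 0)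
          = ∑ g : Bool × Bool, ∑ a : ZMod 3, ∑ k ∈ range 6,
          (if mem i (((RA p v t) ^ (k * p)).symm (g, a, b')).1 (((RA p v t) ^ (k * p)).symm (g, a, b')).2.1 = true
            then μ (g, a, b') else 0) :=
        sum_comm.trans (sum_congr rfl fun g _ => sum_comm)
      rw [hsw, mul_sum]
      refine sum_le_sum fun g _ => ?_
      rw [mul_sum]
      refine sum_le_sum fun a _ => ?_
      rw [← sum_filter, sum_const, nsmul_eq_mul]
      have hc : (2 : ℝ) ≤ ((range 6).filter fun k =>
          mem i (((RA p v t) ^ (k * p)).symm (g, a, b')).1 (((RA p v t) ^ (k * p)).symm (g, a, b')).2.1 = true).card := by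
        exact_mod_cast twist_count_ge_two p v hv h3 t (g, a, b') i
      exact mul_le_mul_of_nonneg_right hc (hμ _)
    have hsum6 : ∑ k ∈ range 6, ((∑ g : Bool × Bool, ∑ a : ZMod 3,
          (if mem i (((RA p v t) ^ (k * p)).symm (g, a, b')).1 (((RA p v t) ^ (k * p)).symm (g, a, b')).2.1 = true
            then μ (g, a, b') else 0))
        - (∑ g : Bool × Bool, ∑ a : ZMod 3, |μ (g, a, b') - μ (((RA p v t) ^ (k * p)).symm (g, a, b'))|))
        ≤ ∑ k ∈ range 6, mass μ i b' := sum_le_sum fun k _ => hk k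
    rw [sum_sub_distrib, sum_const, card_range, nsmul_eq_mul] at hsum6
    push_cast at hsum6
    linarith
  -- sum over the fibres
  have hsum : ∑ b' : ZMod p, ((∑ g : Bool × Bool, ∑ a : ZMod 3, μ (g, a, b')) / 3
        - (∑ k ∈ range 6, ∑ g : Bool × Bool, ∑ a : ZMod 3,
            |μ (g, a, b') - μ (((RA p v t) ^ (k * p)).symm (g, a, b'))|) / 6)
      = (∑ x, μ x) / 3 - (∑ k ∈ range 6, l1 μ (fun x => μ (((RA p v t) ^ (k * p)).symm x))) / 6 := by
    rw [sum_sub_distrib, ← sum_div, ← sum_div, ← sum_St, sum_comm]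
    congr 2
    refine sum_congr rfl fun k _ => ?_
    unfold l1; rw [sum_St]
  have h15 : ∑ k ∈ range 6, l1 μ (fun x => μ (((RA p v t) ^ (k * p)).symm x)) ≤ 15 * p * D1A p v t μ := by
    calc ∑ k ∈ range 6, l1 μ (fun x => μ (((RA p v t) ^ (k * p)).symm x))
        ≤ ∑ k ∈ range 6, ((k * p : ℕ) : ℝ) * D1A p v t μ := sum_le_sum fun k _ => herr k
      _ = 15 * p * D1A p v t μ := by simp [Finset.sum_range_succ]; ring
  calc (∑ x, μ x) / 3 - 5 / 2 * p * D1A p v t μ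
      ≤ (∑ x, μ x) / 3 - (∑ k ∈ range 6, l1 μ (fun x => μ (((RA p v t) ^ (k * p)).symm x))) / 6 := by linarith
    _ = ∑ b' : ZMod p, ((∑ g : Bool × Bool, ∑ a : ZMod 3, μ (g, a, b')) / 3
        - (∑ k ∈ range 6, ∑ g : Bool × Bool, ∑ a : ZMod 3,
            |μ (g, a, b') - μ (((RA p v t) ^ (k * p)).symm (g, a, b'))|) / 6) := hsum.symm
    _ ≤ ∑ b' : ZMod p, (univ : Finset Idx).inf' ⟨(0, none), mem_univ _⟩ (fun i => mass μ i b') :=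
        sum_le_sum fun b' _ => le_inf' _ _ fun i _ => hfib b' i
    _ = phi μ := rfl

end Floor

/-! ## §7 `Φ` along the adaptive process and the count -/

section Count

variable {n : ℕ} (p : ℕ) [NeZero p] (v : ℕ → Bool → ZMod p → ZMod 3 → Bool × Bool) (W : Finset (Fin n)) (b : Fin n → Bool)

/-- `Φ` is invariant under the inverse of a fibre-wise admissible fire (the same map). -/
theorem phi_fireA_symm (μ : St p → ℝ) (w : ZMod p → ZMod 3 → Bool × Bool) (hw : ∀ b, w b ∈ Adm) :
    phi (fun x => μ ((fireA p w).symm x)) = phi μ :=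
  phi_fireA μ w hw

/-- `Φ` is invariant under the inverse branch bijections `(bitEq β ∘ fireA w)⁻¹`. -/
theorem phi_branchA (μ : St p → ℝ) (w : ZMod p → ZMod 3 → Bool × Bool) (hw : ∀ b, w b ∈ Adm) (β : Bool) :
    phi (fun x => μ ((fireA p w).symm ((bitEq p β).symm x))) = phi μ :=
  (phi_comp_bitEq_symm p (fun z => μ ((fireA p w).symm z)) β).trans (phi_fireA_symm p μ w hw)

variable (hv : ∀ t β b, v t β b ∈ Adm)
include hv

/-- `Φ(lawA t) ≥ 2ⁿ/3 − (5p/2)·D1A t (lawA t)`. -/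
theorem phi_lawA_ge (h3 : ¬ 3 ∣ p) (t : ℕ) :
    (2 : ℝ) ^ n / 3 - 5 / 2 * p * D1A p v t (lawA p v W b t) ≤ phi (lawA p v W b t) := by
  have h := phi_ge_third_twist p v hv h3 t (lawA p v W b t) (lawA_nonneg p v W b t)
  rwa [sum_lawA] at h

/-- **`Φ` does not decrease along the adaptive subcube process.** -/
theorem phi_lawA_mono {t s : ℕ} (hts : t ≤ s) (hs : s ≤ n) : phi (lawA p v W b t) ≤ phi (lawA p v W b s) := by
  induction s, hts using Nat.le_induction with
  | base => exact le_rfl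
  | succ s hts ih =>
    have hsn : s < n := hs
    refine (ih hsn.le).trans ?_
    by_cases hW : (⟨s, hsn⟩ : Fin n) ∈ W
    · have hfun : lawA p v W b (s + 1) = fun x : St p =>
          lawA p v W b s ((fireA p (v s (b ⟨s, hsn⟩))).symm ((bitEq p (b ⟨s, hsn⟩)).symm x)) := by
        funext x; exact lawA_succ_frozen p v W b ⟨s, hsn⟩ hW x
      rw [hfun, phi_branchA p _ _ (hv s _)]
    · have h := phi_avg_le p (fun x : St p => lawA p v W b s ((fireA p (v s false)).symm ((bitEq p false).symm x)))
        (fun x : St p => lawA p v W b s ((fireA p (v s true)).symm ((bitEq p true).symm x)))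
      rw [phi_branchA p _ _ (hv s false), phi_branchA p _ _ (hv s true)] at h
      have e : (fun x : St p =>
          (lawA p v W b s ((fireA p (v s false)).symm ((bitEq p false).symm x))
            + lawA p v W b s ((fireA p (v s true)).symm ((bitEq p true).symm x))) / 2)
          = lawA p v W b (s + 1) := by
        funext x; exact (lawA_succ_free p v W b ⟨s, hsn⟩ hW x).symm
      rw [e] at h
      linarith

/-- the `L_{i₀}`-count of the final-fired state: `≥ 2ⁿ/3 − (5p/2)·D1A t (lawA t)` for every column `κ`, `t ≤ n`. -/
theorem card_memA_ge (h3 : ¬ 3 ∣ p) (vf : ZMod p → ZMod 3 → Bool × Bool) (hvf : ∀ b, vf b ∈ Adm) (κ : ZMod 3)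
    {t : ℕ} (ht : t ≤ n) :
    (2 : ℝ) ^ n / 3 - 5 / 2 * p * D1A p v t (lawA p v W b t)
      ≤ ((univ.filter fun u : Fin n → Bool =>
          mem (κ, none) (fireA p vf (XA p v (subcubeMerge W b u) n)).1
            (fireA p vf (XA p v (subcubeMerge W b u) n)).2.1 = true).card : ℝ) := by
  rw [card_memA_eq p v W b vf (κ, none)]
  refine ((phi_lawA_ge p v W b hv h3 t).trans (phi_lawA_mono p v W b hv ht le_rfl)).trans ?_
  rw [← phi_fireA (lawA p v W b n) vf hvf]
  exact phi_le_mass_sum _ _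

/-- **THE BOUND**: outside `L_{(κ,0)}` at the end for at most `(2/3 + 5p√(12p/(m+1)))·2ⁿ` merged inputs. -/
theorem card_not_memA_le (h3 : ¬ 3 ∣ p) (vf : ZMod p → ZMod 3 → Bool × Bool) (hvf : ∀ b, vf b ∈ Adm) (κ : ZMod 3) :
    ((univ.filter fun u : Fin n → Bool =>
        mem (κ, none) (fireA p vf (XA p v (subcubeMerge W b u) n)).1
          (fireA p vf (XA p v (subcubeMerge W b u) n)).2.1 = false).card : ℝ)
      ≤ (2 / 3 + 5 * p * Real.sqrt (12 * p / ((n - W.card : ℕ) + 1))) * (2 : ℝ) ^ n := by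
  set m := n - W.card with hmdef
  set P : (Fin n → Bool) → Bool := fun u =>
    mem (κ, none) (fireA p vf (XA p v (subcubeMerge W b u) n)).1
      (fireA p vf (XA p v (subcubeMerge W b u) n)).2.1 with hP
  have hsplit : ((univ.filter fun u : Fin n → Bool => P u = false).card : ℝ)
      + ((univ.filter fun u : Fin n → Bool => P u = true).card : ℝ) = (2 : ℝ) ^ n := by
    have h := card_filter_add_card_filter_not (s := (univ : Finset (Fin n → Bool))) (fun u : Fin n → Bool => P u = false)
    rw [card_univ, Fintype.card_fun, Fintype.card_bool, Fintype.card_fin] at h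
    have e : (univ.filter fun u : Fin n → Bool => ¬ P u = false) = univ.filter fun u : Fin n → Bool => P u = true := by
      congr 1; ext u; simp
    rw [e] at h
    exact_mod_cast h
  have hp : (0 : ℝ) < p := by exact_mod_cast NeZero.pos p
  have hsq : 0 ≤ Real.sqrt (12 * p / ((m : ℝ) + 1)) := Real.sqrt_nonneg _
  have hM : (0 : ℝ) < (2 : ℝ) ^ n := pow_pos (by norm_num) n
  by_cases hmn : 12 * p < m + 1
  · obtain ⟨t, _, hD⟩ := exists_D1A_le_free p v W b hmn
    have hl := card_memA_ge p v W b hv h3 vf hvf κ (t.isLt.le)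
    have hpD : (p : ℝ) * D1A p v t.val (lawA p v W b t.val)
        ≤ p * (2 * (2 : ℝ) ^ n * Real.sqrt (12 * p / ((m : ℝ) + 1))) :=
      mul_le_mul_of_nonneg_left hD hp.le
    show ((univ.filter fun u : Fin n → Bool => P u = false).card : ℝ) ≤ _
    have hl' : (2 : ℝ) ^ n / 3 - 5 / 2 * p * D1A p v t.val (lawA p v W b t.val)
        ≤ ((univ.filter fun u : Fin n → Bool => P u = true).card : ℝ) := hl
    linarith
  · have h1 : 1 ≤ Real.sqrt (12 * p / ((m : ℝ) + 1)) := by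
      rw [Real.one_le_sqrt, one_le_div (by positivity)]
      exact_mod_cast not_lt.mp hmn
    show ((univ.filter fun u : Fin n → Bool => P u = false).card : ℝ) ≤ _
    have hwin : 0 ≤ ((univ.filter fun u : Fin n → Bool => P u = true).card : ℝ) := Nat.cast_nonneg _
    have hp1 : (1 : ℝ) ≤ p := by exact_mod_cast NeZero.pos p
    have hps : (1 : ℝ) ≤ p * Real.sqrt (12 * p / ((m : ℝ) + 1)) := by
      have := mul_le_mul hp1 h1 zero_le_one hp.le
      rwa [one_mul] at this
    have hco : (2 : ℝ) ^ n ≤ (2 / 3 + 5 * p * Real.sqrt (12 * p / ((m : ℝ) + 1))) * (2 : ℝ) ^ n := by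
      have : (1 : ℝ) ≤ 2 / 3 + 5 * p * Real.sqrt (12 * p / ((m : ℝ) + 1)) := by linarith
      nlinarith
    linarith

end Count

end CounterLaw

/-! ## §8 The theorem -/

open CounterLaw in
/-- **E4 — ONE-STEP ADAPTIVE COUNTER STRATEGIES ON SUBCUBES — PROVED (`3 ∤ p`).**  For every family of branch- and
fibre-dependent admissible fires `v t β b`, every final fibre-wise admissible fire `vf`, every subcube `{u_W = b_W}` and every
column `κ`: the adaptive process ends outside the LOSE member `L_{(κ,0)}` on at most `(2/3 + 5p·√(12p/(n − |W| + 1)))·2ⁿ`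
merged inputs. -/
theorem adaptiveSubcube_sharp (p : ℕ) (h3 : ¬ 3 ∣ p) (hp : 0 < p) {n : ℕ}
    (v : ℕ → Bool → ZMod p → ZMod 3 → Bool × Bool) (hv : ∀ t β b, v t β b ∈ CounterLaw.Adm)
    (vf : ZMod p → ZMod 3 → Bool × Bool) (hvf : ∀ b, vf b ∈ CounterLaw.Adm)
    (W : Finset (Fin n)) (b : Fin n → Bool) (κ : ZMod 3) :
    ((univ.filter fun u : Fin n → Bool =>
        mem (κ, none) (fireA p vf (XA p v (AffBells22.subcubeMerge W b u) n)).1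
          (fireA p vf (XA p v (AffBells22.subcubeMerge W b u) n)).2.1 = false).card : ℝ)
      ≤ (2 / 3 + 5 * p * Real.sqrt (12 * p / ((n - W.card : ℕ) + 1))) * (2 : ℝ) ^ n := by
  haveI : NeZero p := ⟨hp.ne'⟩
  exact card_not_memA_le p v W b hv h3 vf hvf κ

end Summit.QuantumAdvantage.AdviceFreeQNC0
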